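import Summits.Ventures.DiscreteObjects.PP12.OrderThree

/-!
# PP(12), planar cell of order 3: the tangent/exterior structure forced by `12 = 3² + 3` (kernel)
Framing: lottery ticket; floor = certified bounds/negative ranges.

Setting: a collineation `σ` of a projective plane of order 12 (Mathlib `Configuration.ProjectivePlane`) whose fixed structure is
PLANAR OF ORDER 3 — exactly 13 fixed points and 13 fixed lines, 4 fixed points on every fixed line, 4 fixed lines through every
fixed point (case 2 of `order_three_structure`, p223288; the hypotheses below are exactly that output, the order of `σ` is not
used). Because `12 = 3² + 3` is the extremal case of Bruck's bound, the fixed subplane `π₀` sits in the plane rigidly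
(cell pub-namedobj, target M; this is the structural entry point of the live `|G| = 3` planar cell):

* a non-fixed point lies on at most one fixed line; the TANGENT points (non-fixed, on a fixed line) number `117`
  (`card_tangent_points`), the EXTERIOR points (on no fixed line) number `27` (`card_exterior_points`);
* every line through an exterior point carries exactly one fixed point (`fixedOnLine_eq_one_of_exterior`);
* a TANGENT line (non-fixed, through a fixed point) carries exactly 1 fixed point, 9 tangent points and 3 exterior points
  (`tangent_line_counts`);
* hence any two exterior points lie on a tangent line carrying exactly 3 exterior points (`exterior_pair_three`): the
  exterior points with the traces of the tangent lines form a Steiner triple system `S(2,3,27)` (117 triples), on which `σ`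
  acts without fixed points or fixed triples (exterior points and tangent lines are non-fixed by definition).
Dual statements (exterior lines / tangent points) follow by applying the file to `σ.dual`; they are not spelled out.
-/

namespace Summit.Ventures.DiscreteObjects.PP12

open Configuration Finset
open scoped Classical

namespace Collineation

variable {P L : Type*} [Membership P L] [ProjectivePlane P L] [Fintype P] [Fintype L]
  [DecidableEq P] [DecidableEq L] (σ : Collineation P L)

omit [Fintype P] [Fintype L] [DecidableEq P] [DecidableEq L] in
/-- A non-fixed point lies on at most one fixed line. -/
theorem fixed_line_unique_of_not_fixed {x : P} (hx : σ.onPoints x ≠ x) {l₁ l₂ : L} (h1 : σ.onLines l₁ = l₁)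
    (h2 : σ.onLines l₂ = l₂) (hx1 : x ∈ l₁) (hx2 : x ∈ l₂) : l₁ = l₂ := by
  by_contra hne
  exact hx (σ.point_fixed_of_two_fixed hx1 hx2 hne h1 h2)

omit [Fintype P] [Fintype L] [DecidableEq P] [DecidableEq L] in
/-- A non-fixed line carries at most one fixed point. -/
theorem fixed_point_unique_of_not_fixed {t : L} (ht : σ.onLines t ≠ t) {x₁ x₂ : P} (h1 : σ.onPoints x₁ = x₁)
    (h2 : σ.onPoints x₂ = x₂) (hx1 : x₁ ∈ t) (hx2 : x₂ ∈ t) : x₁ = x₂ := by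
  by_contra hne
  exact ht (σ.line_fixed_of_two_fixed hx1 hx2 hne h1 h2)

section Planar

variable (h12 : ProjectivePlane.order P L = 12)
include h12

/-- **Tangent points: 117.** The non-fixed points lying on a fixed line are partitioned by the 13 fixed lines, 9 on each. -/
theorem card_tangent_points (hg13 : fixedCard σ.onLines = 13) (hk4 : ∀ l : L, σ.onLines l = l → σ.fixedOnLine l = 4) :
    (univ.filter fun x : P => σ.onPoints x ≠ x ∧ ∃ l : L, σ.onLines l = l ∧ x ∈ l).card = 117 := by
  set Tn : Finset P := univ.filter fun x : P => σ.onPoints x ≠ x ∧ ∃ l : L, σ.onLines l = l ∧ x ∈ l with hTn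
  set T : Finset L := univ.filter fun m : L => σ.onLines m = m with hT
  have hTcard : T.card = 13 := hg13
  have hLpos : 0 < Fintype.card L := by rw [ProjectivePlane.card_lines P L]; positivity
  obtain ⟨l₀⟩ := Fintype.card_pos_iff.mp hLpos
  -- the fixed line of a tangent point
  let φ : P → L := fun x => if h : ∃ l : L, σ.onLines l = l ∧ x ∈ l then h.choose else l₀
  have hφ : ∀ x ∈ Tn, σ.onLines (φ x) = φ x ∧ x ∈ φ x := by
    intro x hx
    have hx' := (Finset.mem_filter.mp hx).2
    simp only [φ, dif_pos hx'.2]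
    exact hx'.2.choose_spec
  have hmaps : ∀ x ∈ Tn, φ x ∈ T := fun x hx => by simp [hT, (hφ x hx).1]
  have hfib : ∀ m ∈ T, (Tn.filter fun x => φ x = m).card = 9 := by
    intro m hm
    have fm : σ.onLines m = m := by simpa [hT] using hm
    -- fibre = non-fixed points of m
    have hset : (Tn.filter fun x => φ x = m)
        = (univ.filter fun x : P => x ∈ m) \ (univ.filter fun x : P => x ∈ m ∧ σ.onPoints x = x) := by
      ext x
      simp only [mem_filter, mem_univ, true_and, mem_sdiff, not_and, hTn]
      constructor
      · rintro ⟨⟨hx, hex⟩, hxm⟩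
        have h := hφ x (by simp [hTn, hx, hex])
        rw [hxm] at h
        exact ⟨h.2, fun _ => hx⟩
      · rintro ⟨hxm, hx⟩
        have hx' : σ.onPoints x ≠ x := fun e => hx hxm e
        have hmem : x ∈ Tn := by simp only [hTn, mem_filter, mem_univ, true_and]; exact ⟨hx', m, fm, hxm⟩
        refine ⟨⟨hx', m, fm, hxm⟩, ?_⟩
        have h := hφ x hmem
        exact σ.fixed_line_unique_of_not_fixed hx' h.1 fm h.2 hxm
    have hsub : (univ.filter fun x : P => x ∈ m ∧ σ.onPoints x = x) ⊆ univ.filter fun x : P => x ∈ m :=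
      fun x hx => by simp only [mem_filter, mem_univ, true_and] at hx ⊢; exact hx.1
    have hall : (univ.filter fun x : P => x ∈ m).card = 13 := by
      rw [← Fintype.card_subtype, ← Nat.card_eq_fintype_card]
      change Configuration.pointCount P m = 13
      rw [ProjectivePlane.pointCount_eq P m, h12]
    have hk : (univ.filter fun x : P => x ∈ m ∧ σ.onPoints x = x).card = 4 := hk4 m fm
    rw [hset, Finset.card_sdiff_of_subset hsub, hall, hk]
  have hsum := Finset.card_eq_sum_card_fiberwise hmaps
  rw [Finset.sum_congr rfl hfib, Finset.sum_const, hTcard] at hsum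
  simpa using hsum

/-- **Exterior points: 27** (`157 − 13 − 117`). -/
theorem card_exterior_points (hf13 : fixedCard σ.onPoints = 13) (hg13 : fixedCard σ.onLines = 13)
    (hk4 : ∀ l : L, σ.onLines l = l → σ.fixedOnLine l = 4) :
    (univ.filter fun x : P => σ.onPoints x ≠ x ∧ ∀ l : L, σ.onLines l = l → x ∉ l).card = 27 := by
  have h117 := σ.card_tangent_points h12 hg13 hk4
  -- non-fixed points: 144, split into tangent and exterior
  have hN : (univ.filter fun x : P => σ.onPoints x ≠ x).card = 144 := by
    have hsplit := Finset.card_filter_add_card_filter_not (s := (univ : Finset P)) (fun x : P => σ.onPoints x = x)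
    rw [Finset.card_univ, ProjectivePlane.card_points P L, h12] at hsplit
    change fixedCard σ.onPoints + _ = _ at hsplit
    rw [hf13] at hsplit
    norm_num at hsplit
    convert (by omega : (univ.filter fun x : P => ¬ σ.onPoints x = x).card = 144) using 2
  have hsplit := Finset.card_filter_add_card_filter_not (s := univ.filter fun x : P => σ.onPoints x ≠ x)
    (fun x : P => ∃ l : L, σ.onLines l = l ∧ x ∈ l)
  rw [Finset.filter_filter, Finset.filter_filter, hN, h117] at hsplit
  have e : (univ.filter fun x : P => σ.onPoints x ≠ x ∧ ¬ ∃ l : L, σ.onLines l = l ∧ x ∈ l)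
      = univ.filter fun x : P => σ.onPoints x ≠ x ∧ ∀ l : L, σ.onLines l = l → x ∉ l := by
    ext x; simp only [mem_filter, mem_univ, true_and, not_exists, not_and]
  rw [e] at hsplit
  omega

/-- **Lines through an exterior point carry exactly one fixed point each.** -/
theorem fixedOnLine_eq_one_of_exterior (hf13 : fixedCard σ.onPoints = 13) {E : P}
    (hE : ∀ l : L, σ.onLines l = l → E ∉ l) {m : L} (hEm : E ∈ m) : σ.fixedOnLine m = 1 := by
  set S : Finset P := univ.filter fun x : P => σ.onPoints x = x with hS
  have hScard : S.card = 13 := hf13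
  have hEfix : σ.onPoints E ≠ E := by
    intro e
    -- E fixed would lie on a fixed line: pick fixed points X ≠ X' and use the line EX (or XX' if E = X)
    obtain ⟨X, hX, X', hX', hXX'⟩ := Finset.one_lt_card.mp (by rw [hScard]; norm_num : 1 < S.card)
    have fX : σ.onPoints X = X := by simpa [hS] using hX
    by_cases hEX : E = X
    · -- E = X fixed; the line through X and X' is fixed and contains E
      subst hEX
      exact hE _ (σ.line_fixed_of_two_fixed (HasLines.mkLine_ax (L := L) hXX').1 (HasLines.mkLine_ax hXX').2 hXX'
        fX (by simpa [hS] using hX')) (HasLines.mkLine_ax hXX').1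
    · exact hE _ (σ.line_fixed_of_two_fixed (HasLines.mkLine_ax (L := L) hEX).1 (HasLines.mkLine_ax hEX).2 hEX e fX)
        (HasLines.mkLine_ax hEX).1
  -- at most one fixed point on any line through E
  have hle : ∀ m' : L, E ∈ m' → σ.fixedOnLine m' ≤ 1 := by
    intro m' hEm'
    unfold fixedOnLine
    refine Finset.card_le_one.mpr fun a ha b hb => ?_
    simp only [mem_filter, mem_univ, true_and] at ha hb
    by_contra hab
    exact hE m' (σ.line_fixed_of_two_fixed ha.1 hb.1 hab ha.2 hb.2) hEm'
  -- the map X ↦ EX from S to the lines through E is injective, so every line through E is hit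
  set LE : Finset L := univ.filter fun m' : L => E ∈ m' with hLE
  have hLE13 : LE.card = 13 := by
    rw [hLE, ← Fintype.card_subtype, ← Nat.card_eq_fintype_card]
    change Configuration.lineCount L E = 13
    rw [ProjectivePlane.lineCount_eq L E, h12]
  let g : P → L := fun X => if h : E = X then m else HasLines.mkLine h
  have hg : ∀ X ∈ S, E ∈ g X ∧ X ∈ g X := by
    intro X hX
    have fX : σ.onPoints X = X := by simpa [hS] using hX
    have hEX : E ≠ X := fun e => hEfix (e ▸ fX)
    simp only [g, dif_neg hEX]
    exact HasLines.mkLine_ax hEX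
  have hmaps : ∀ X ∈ S, g X ∈ LE := fun X hX => by simp [hLE, (hg X hX).1]
  have hinj : Set.InjOn g S := by
    intro X hX X' hX' heq
    by_contra hXX'
    have fX : σ.onPoints X = X := by simpa [hS] using hX
    have fX' : σ.onPoints X' = X' := by simpa [hS] using hX'
    obtain ⟨hEm', hXm'⟩ := hg X hX
    obtain ⟨-, hX'm'⟩ := hg X' hX'
    rw [← heq] at hX'm'
    have h2 : 2 ≤ σ.fixedOnLine (g X) := by
      unfold fixedOnLine
      have hsub : ({X, X'} : Finset P) ⊆ univ.filter fun x : P => x ∈ g X ∧ σ.onPoints x = x := by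
        intro x hx
        simp only [Finset.mem_insert, Finset.mem_singleton] at hx
        rcases hx with rfl | rfl <;> simp [hXm', hX'm', fX, fX']
      have := Finset.card_le_card hsub
      rwa [Finset.card_pair hXX'] at this
    have := hle (g X) hEm'
    omega
  -- image has 13 elements, so it is all of LE; m ∈ LE is hit by some fixed X
  have himg : (S.image g) = LE := by
    apply Finset.eq_of_subset_of_card_le
    · intro m' hm'
      obtain ⟨X, hX, rfl⟩ := Finset.mem_image.mp hm'
      exact hmaps X hX
    · rw [Finset.card_image_of_injOn hinj, hScard, hLE13]
  have hm : m ∈ S.image g := by rw [himg]; simp [hLE, hEm]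
  obtain ⟨X, hX, hXm⟩ := Finset.mem_image.mp hm
  have fX : σ.onPoints X = X := by simpa [hS] using hX
  have hXm' : X ∈ m := by rw [← hXm]; exact (hg X hX).2
  have h1 : 1 ≤ σ.fixedOnLine m := by
    unfold fixedOnLine
    exact Finset.card_pos.mpr ⟨X, by simp [hXm', fX]⟩
  have := hle m hEm
  omega

/-- **Tangent lines.** A non-fixed line `t` through a fixed point `X` carries exactly 1 fixed point, exactly 9 tangent points
and exactly 3 exterior points. -/
theorem tangent_line_counts (hg13 : fixedCard σ.onLines = 13) (ht4 : ∀ x : P, σ.onPoints x = x → σ.fixedThrough x = 4)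
    {t : L} (ht : σ.onLines t ≠ t) {X : P} (hX : σ.onPoints X = X) (hXt : X ∈ t) :
    σ.fixedOnLine t = 1 ∧
    (univ.filter fun y : P => y ∈ t ∧ σ.onPoints y ≠ y ∧ ∃ l : L, σ.onLines l = l ∧ y ∈ l).card = 9 ∧
    (univ.filter fun y : P => y ∈ t ∧ σ.onPoints y ≠ y ∧ ∀ l : L, σ.onLines l = l → y ∉ l).card = 3 := by
  -- (1) exactly one fixed point on t
  have h1 : σ.fixedOnLine t = 1 := by
    unfold fixedOnLine
    rw [Finset.card_eq_one]
    refine ⟨X, ?_⟩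
    ext y
    simp only [mem_filter, mem_univ, true_and, mem_singleton]
    constructor
    · rintro ⟨hyt, fy⟩; exact σ.fixed_point_unique_of_not_fixed ht fy hX hyt hXt
    · rintro rfl; exact ⟨hXt, hX⟩
  -- (2) tangent points on t ↔ fixed lines not through X
  set T : Finset L := univ.filter fun m : L => σ.onLines m = m with hT
  set TX : Finset L := T.filter fun m => X ∉ m with hTX
  have hTXcard : TX.card = 9 := by
    have h4 : (T.filter fun m => X ∈ m).card = 4 := by
      have := ht4 X hX
      unfold fixedThrough at this
      rw [← this]; congr 1; ext m; simp [hT, and_comm]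
    have hsplit := Finset.card_filter_add_card_filter_not (s := T) (fun m : L => X ∈ m)
    have hTcard : T.card = 13 := hg13
    rw [h4, hTcard] at hsplit
    simpa [hTX] using (by omega : (T.filter fun m => ¬ X ∈ m).card = 9)
  set Tg : Finset P := univ.filter fun y : P => y ∈ t ∧ σ.onPoints y ≠ y ∧ ∃ l : L, σ.onLines l = l ∧ y ∈ l with hTg
  -- the map m ↦ m ∩ t from TX to Tg is a bijection; we use two injections
  have hmeet : ∀ m ∈ TX, m ≠ t := fun m hm e => by
    have := (Finset.mem_filter.mp hm).2; exact this (e ▸ hXt)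
  let ψ : L → P := fun m => if h : m ≠ t then HasPoints.mkPoint h else X
  have hψ : ∀ m ∈ TX, ψ m ∈ m ∧ ψ m ∈ t ∧ σ.onPoints (ψ m) ≠ ψ m := by
    intro m hm
    have hne := hmeet m hm
    have fm : σ.onLines m = m := by have := (Finset.mem_filter.mp hm).1; simpa [hT] using this
    have hXm : X ∉ m := (Finset.mem_filter.mp hm).2
    simp only [ψ, dif_pos hne]
    refine ⟨(HasPoints.mkPoint_ax hne).1, (HasPoints.mkPoint_ax hne).2, fun fy => ?_⟩
    -- a second fixed point on t
    have := σ.fixed_point_unique_of_not_fixed ht fy hX (HasPoints.mkPoint_ax hne).2 hXt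
    exact hXm (this ▸ (HasPoints.mkPoint_ax hne).1)
  have hψmaps : ∀ m ∈ TX, ψ m ∈ Tg := by
    intro m hm
    obtain ⟨h1m, h2m, h3m⟩ := hψ m hm
    have fm : σ.onLines m = m := by have := (Finset.mem_filter.mp hm).1; simpa [hT] using this
    simp only [hTg, mem_filter, mem_univ, true_and]
    exact ⟨h2m, h3m, m, fm, h1m⟩
  have hψinj : Set.InjOn ψ TX := by
    intro m hm m' hm' heq
    obtain ⟨h1m, -, h3m⟩ := hψ m hm
    obtain ⟨h1m', -, -⟩ := hψ m' hm'
    have fm : σ.onLines m = m := by have := (Finset.mem_filter.mp hm).1; simpa [hT] using this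
    have fm' : σ.onLines m' = m' := by have := (Finset.mem_filter.mp hm').1; simpa [hT] using this
    rw [← heq] at h1m'
    exact σ.fixed_line_unique_of_not_fixed h3m fm fm' h1m h1m'
  have hge : 9 ≤ Tg.card := by
    have := Finset.card_le_card_of_injOn ψ hψmaps hψinj
    rwa [hTXcard] at this
  -- reverse injection: tangent point y ↦ its fixed line, which misses X
  have hLpos : 0 < Fintype.card L := by rw [ProjectivePlane.card_lines P L]; positivity
  obtain ⟨l₀⟩ := Fintype.card_pos_iff.mp hLpos
  let φ : P → L := fun y => if h : ∃ l : L, σ.onLines l = l ∧ y ∈ l then h.choose else l₀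
  have hφ : ∀ y ∈ Tg, σ.onLines (φ y) = φ y ∧ y ∈ φ y ∧ X ∉ φ y := by
    intro y hy
    obtain ⟨hyt, hyfix, hex⟩ := by simpa [hTg] using hy
    have hc : σ.onLines (φ y) = φ y ∧ y ∈ φ y := by simp only [φ, dif_pos hex]; exact hex.choose_spec
    refine ⟨hc.1, hc.2, fun hXφ => ?_⟩
    -- X, y ∈ φ y and X, y ∈ t with y ≠ X ⇒ φ y = t, contradiction with t non-fixed
    have hyX : y ≠ X := fun e => hyfix (e ▸ hX)
    have : φ y = t := (Nondegenerate.eq_or_eq hc.2 hXφ hyt hXt).resolve_left hyX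
    exact ht (this ▸ hc.1)
  have hφmaps : ∀ y ∈ Tg, φ y ∈ TX := fun y hy => by
    obtain ⟨h1y, -, h3y⟩ := hφ y hy
    simp [hTX, hT, h1y, h3y]
  have hφinj : Set.InjOn φ Tg := by
    intro y hy y' hy' heq
    obtain ⟨h1y, h2y, -⟩ := hφ y hy
    obtain ⟨-, h2y', -⟩ := hφ y' hy'
    rw [← heq] at h2y'
    obtain ⟨hyt, hyfix, -⟩ := by simpa [hTg] using hy
    obtain ⟨hy't, -, -⟩ := by simpa [hTg] using hy'
    by_contra hne
    -- y, y' ∈ φ y ∩ t ⇒ φ y = t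
    have : φ y = t := (Nondegenerate.eq_or_eq h2y h2y' hyt hy't).resolve_left hne
    exact ht (this ▸ h1y)
  have hle : Tg.card ≤ 9 := by
    have := Finset.card_le_card_of_injOn φ hφmaps hφinj
    rwa [hTXcard] at this
  have h9 : Tg.card = 9 := le_antisymm hle hge
  -- (3) the remaining 3 points of t are exterior
  have hall : (univ.filter fun y : P => y ∈ t).card = 13 := by
    rw [← Fintype.card_subtype, ← Nat.card_eq_fintype_card]
    change Configuration.pointCount P t = 13
    rw [ProjectivePlane.pointCount_eq P t, h12]
  have hsplit1 := Finset.card_filter_add_card_filter_not (s := univ.filter fun y : P => y ∈ t)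
    (fun y : P => σ.onPoints y = y)
  have hfix1 : ((univ.filter fun y : P => y ∈ t).filter fun y => σ.onPoints y = y).card = 1 := by
    rw [← h1]; unfold fixedOnLine; congr 1; ext y; simp
  have hsplit2 := Finset.card_filter_add_card_filter_not
    (s := (univ.filter fun y : P => y ∈ t).filter fun y => ¬ σ.onPoints y = y)
    (fun y : P => ∃ l : L, σ.onLines l = l ∧ y ∈ l)
  have e1 : (((univ.filter fun y : P => y ∈ t).filter fun y => ¬ σ.onPoints y = y).filter
      fun y => ∃ l : L, σ.onLines l = l ∧ y ∈ l) = Tg := by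
    ext y; simp only [hTg, mem_filter, mem_univ, true_and, and_assoc]
  have e2 : (((univ.filter fun y : P => y ∈ t).filter fun y => ¬ σ.onPoints y = y).filter
      fun y => ¬ ∃ l : L, σ.onLines l = l ∧ y ∈ l)
      = univ.filter fun y : P => y ∈ t ∧ σ.onPoints y ≠ y ∧ ∀ l : L, σ.onLines l = l → y ∉ l := by
    ext y; simp only [mem_filter, mem_univ, true_and, not_exists, not_and, and_assoc]
  rw [e1, e2, h9] at hsplit2
  rw [hfix1, hall] at hsplit1
  refine ⟨h1, h9, ?_⟩
  omega

/-- **The exterior points form a Steiner triple system.** The line joining an exterior point `E` to any other point `E'`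
(in particular to another exterior point) is a tangent line carrying exactly 3 exterior points. -/
theorem exterior_pair_three (hf13 : fixedCard σ.onPoints = 13) (hg13 : fixedCard σ.onLines = 13)
    (ht4 : ∀ x : P, σ.onPoints x = x → σ.fixedThrough x = 4) {E E' : P}
    (hE : σ.onPoints E ≠ E ∧ ∀ l : L, σ.onLines l = l → E ∉ l) (hne : E ≠ E') :
    σ.onLines (HasLines.mkLine hne : L) ≠ HasLines.mkLine hne ∧
    (univ.filter fun y : P => y ∈ (HasLines.mkLine hne : L) ∧ σ.onPoints y ≠ y ∧
      ∀ l : L, σ.onLines l = l → y ∉ l).card = 3 := by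
  set m : L := HasLines.mkLine hne
  have hEm : E ∈ m := (HasLines.mkLine_ax hne).1
  have hm : σ.onLines m ≠ m := fun fm => hE.2 m fm hEm
  -- m carries exactly one fixed point X
  have h1 := σ.fixedOnLine_eq_one_of_exterior h12 hf13 hE.2 hEm
  obtain ⟨X, hX⟩ := Finset.card_eq_one.mp h1
  have hX' : X ∈ m ∧ σ.onPoints X = X := by
    have : X ∈ univ.filter fun p : P => p ∈ m ∧ σ.onPoints p = p := by rw [hX]; simp
    simpa using this
  exact ⟨hm, (σ.tangent_line_counts h12 hg13 ht4 hm hX'.2 hX'.1).2.2⟩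

end Planar

end Collineation

end Summit.Ventures.DiscreteObjects.PP12

namespace Summit.Ventures.DiscreteObjects.PP12

open Configuration Finset
open scoped Classical

namespace Collineation

variable {P L : Type*} [Membership P L] [ProjectivePlane P L] [Fintype P] [Fintype L]
  [DecidableEq P] [DecidableEq L] (σ : Collineation P L)

/-- **Dual exterior structure (exterior LINES).** In the planar setting of this file the lines carrying no fixed point and not
fixed (exterior lines) number 27, and the meet of two distinct exterior lines is a point lying on exactly 3 exterior lines — the
exterior lines also form an `S(2,3,27)` (blocks = tangent points). Obtained from `card_exterior_points` and `exterior_pair_three` for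
the dual collineation. -/
theorem exterior_lines_structure (h12 : ProjectivePlane.order P L = 12) (hf13 : fixedCard σ.onPoints = 13)
    (hg13 : fixedCard σ.onLines = 13) (hk4 : ∀ l : L, σ.onLines l = l → σ.fixedOnLine l = 4)
    (ht4 : ∀ x : P, σ.onPoints x = x → σ.fixedThrough x = 4) :
    (univ.filter fun m : L => σ.onLines m ≠ m ∧ ∀ x : P, σ.onPoints x = x → x ∉ m).card = 27 ∧
    ∀ {m m' : L}, (σ.onLines m ≠ m ∧ ∀ x : P, σ.onPoints x = x → x ∉ m) → ∀ hne : m ≠ m',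
      (univ.filter fun t : L => (HasPoints.mkPoint hne : P) ∈ t ∧ σ.onLines t ≠ t ∧
        ∀ x : P, σ.onPoints x = x → x ∉ t).card = 3 := by
  have h12' : ProjectivePlane.order (Dual L) (Dual P) = 12 := by rw [ProjectivePlane.Dual.order]; exact h12
  have hk4' : ∀ x : Dual P, σ.dual.onLines x = x → σ.dual.fixedOnLine x = 4 := fun x hx => by
    rw [← fixedThrough_eq_dual]; exact ht4 x hx
  have ht4' : ∀ m : Dual L, σ.dual.onPoints m = m → σ.dual.fixedThrough m = 4 := fun m hm => by
    have h := hk4 m hm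
    have e : σ.dual.fixedThrough m = σ.fixedOnLine m := by
      unfold fixedThrough fixedOnLine; rfl
    rw [e]; exact h
  refine ⟨σ.dual.card_exterior_points h12' hg13 hf13 hk4', fun hm hne => ?_⟩
  exact (σ.dual.exterior_pair_three h12' hg13 hf13 ht4' hm hne).2

end Collineation

end Summit.Ventures.DiscreteObjects.PP12
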